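import Summits.Ventures.YMGap.RobustBall.LoopActionMassive
import Summits.Ventures.YMGap.RobustBall.RectangleLoopFamily
import Summits.Ventures.YMGap.RobustBall.ShapeLoopFamily
import HarnessLib

/-!
# Venture YMGap, track ROBUST-BALL (tier 2) — ALL RECTANGLES, ALL CLOSED TRAILS, ALL TRAIL SHAPES: the explicit
# loop families of the norm ball are MASSIVE theories (every DLR state `IsMassiveState`)

HONEST FRAMING. WHAT THIS IS: a venture file (cell `pub-ymgap`, track Y2 ROBUST-BALL, seat ds-3): the massive
reading (`LoopActionMassive.lean`) of rb-p1's three worked loop families — `rectLoop` (ALL rectangular loops of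
`ℤ⁴`: every base point, plane, size; `RectangleLoopFamily.lean`), `trailLoop` (ALL nontrivial closed trails at
once; `TrailLoopFamily.lean`) and `shapeLoop trailShape` (TRANSLATION-INVARIANT generalized Wilson actions over all
closed trail shapes, plain weighted `ℓ¹` norm on shape couplings; `ShapeLoopFamily.lean`) — with rb-p1's finite-fibre
theorems and norm bounds VERBATIM and the massive loop-ball cells in place of the clustering cells. RESULTS
(`d = 4`; DLR states exist and EVERY DLR state is an Osterwalder–Seiler MASSIVE STATE with exponentially decaying
plaquette–plaquette correlation function): `SU(2)` at `β_W = 1/16` for every rectangle-coupling family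
`|c_{x,ab,R,T}| ≤ 64^{-(R+T)}` (`su2_rectFamily_massive_1_16`, hypothesis-free) and every `N ≥ 2` at 't Hooft `1/64`
for `|c| ≤ ½·64^{-(R+T)}` (`suN_rectFamily_massive_1_64`); every coupling function on all closed trails with
`‖c‖_{log 2} ≤ 0.143` at `β_W = 1/16` (`su2_allTrails_massive_1_16`), `≤ 0.209` at `β_W = 1/20`, every `N ≥ 2` with
`‖c‖_{log 6/5} ≤ 1/40` at `1/64` (`suN_allTrails_massive_1_64`), `SU(3)` given H1/H2 at `β_W = 1/8`
(`su3_allTrails_massive_1_8`); translation-invariant actions with `∑_s |c₀(s)| |s|² 4^{|s|} ≤ 0.143` at `β_W = 1/16`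
(`su2_trailShapes_massive_1_16`) and `∑_s |c₀(s)| |s|² (36/25)^{|s|} ≤ 1/40` for every `N ≥ 2` at `1/64`
(`suN_trailShapes_massive_1_64`). WHAT IT IS NOT: no new radius; strong-coupling lattice statements inside the rows'
windows; nothing about the continuum limit, confinement or the Clay Millennium problem.

References: rb-p1 `RectangleLoopFamily.lean`, `TrailLoopFamily.lean`, `ShapeLoopFamily.lean`, `LoopActionMember.lean`;
ds-3 `LoopActionMassive.lean`, `RowsSMassive.lean`; K. Osterwalder, E. Seiler, Ann. Phys. 110 (1978) 440, §4.
-/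

noncomputable section

open MeasureTheory ProbabilityTheory Function Finset Filter Topology Real
open scoped NNReal
open Literature.Probability.LatticeModels
open Literature.MathematicalPhysics.QuantumLattice
open Literature.MathematicalPhysics.QuantumFieldTheory hiding ZdEdge Site
open Literature.Barriers.QuantumFields (IsMassiveState)
open Summit.QuantumFields.BalabanUV.InfraRed.StrongCouplingPoincareDoorSUN (OneLinkPoincareSUN)
open Summit.QuantumFields.BalabanUV.InfraRed.StrongCouplingVarianceDoorSUN (OneLinkVarianceBound)

namespace Summit.Ventures.YMGap.RobustBall

/-! ### All rectangles -/

section Rectangles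

/-- ★ **`SU(2)`, `d = 4`, `β_W = 1/16` — ALL RECTANGLES AT ONCE, hypothesis-free, MASSIVE**: the action
`S_Wilson + ∑_{x, a<b, R, T ≥ 1} c_{x,ab,R,T} · Re tr U_{∂(R×T at x in ab)}/2` with `|c_{x,ab,R,T}| ≤ 64^{-(R+T)}` has DLR
states on `ℤ⁴`, and EVERY DLR state is massive (rate `log 2`) with plaquette–plaquette decay (norm `≤ 6/49 ≤ 0.143`,
massive cell `su2_loopFamily_massive_1_16`; rb-p1's clustering row `su2_rectFamily_massGapS_1_16`). -/
theorem su2_rectFamily_massive_1_16 {c : RectIdx 4 → ℝ} (hc : ∀ i, |c i| ≤ (1 / 64 : ℝ) ^ (i.2.1 + i.2.2 + 2)) :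
    (perturbedGibbsMeasuresS (d := 4) (fundamentalRep (Fin 2)) (((2 : ℕ) : ℝ) * ((1 / 16 : ℝ) / 4))
        (loopFamilyAction (d := 4) 2 rectLoop c)).Nonempty ∧
      ∀ μ ∈ perturbedGibbsMeasuresS (d := 4) (fundamentalRep (Fin 2)) (((2 : ℕ) : ℝ) * ((1 / 16 : ℝ) / 4))
          (loopFamilyAction (d := 4) 2 rectLoop c),
        IsMassiveState μ ∧ HasExponentialDecay (plaquetteCorrFn (fundamentalRep (Fin 2)) μ) := by
  have hq : exp (Real.log 2) = 2 := Real.exp_log (by norm_num)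
  have h := loopNormLE_rectLoop (d := 4) (w := Real.log 2) (ρ := 1 / 64) (τ := 1) (c := c)
    (Real.log_nonneg (by norm_num)) (by norm_num) (by norm_num) (by rw [hq]; norm_num)
    (fun i => by rw [one_mul]; exact hc i)
  have hP : Fintype.card {p : Fin 4 × Fin 4 // p.1 < p.2} = 6 := by decide
  rw [hq, hP] at h
  exact su2_loopFamily_massive_1_16 finite_fibre_rectLoop (h.mono (by norm_num))

/-- ★ **Every `N ≥ 2`, `d = 4`, 't Hooft `1/64` — all rectangles, hypothesis-free, `N`-uniform, MASSIVE**: for every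
coupling family with `|c_{x,ab,R,T}| ≤ ½ · 64^{-(R+T)}`, DLR states exist and every DLR state is massive (rate
`log (6/5)`) with plaquette–plaquette decay (massive cell `suN_loopFamily_massive_1_64`; rb-p1's
`suN_rectFamily_massGapS_1_64`). -/
theorem suN_rectFamily_massive_1_64 {N : ℕ} (hN : 2 ≤ N) {c : RectIdx 4 → ℝ}
    (hc : ∀ i, |c i| ≤ 1 / 2 * (1 / 64 : ℝ) ^ (i.2.1 + i.2.2 + 2)) :
    (perturbedGibbsMeasuresS (d := 4) (fundamentalRep (Fin N)) ((N : ℝ) * (1 / 64))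
        (loopFamilyAction (d := 4) N rectLoop c)).Nonempty ∧
      ∀ μ ∈ perturbedGibbsMeasuresS (d := 4) (fundamentalRep (Fin N)) ((N : ℝ) * (1 / 64))
          (loopFamilyAction (d := 4) N rectLoop c),
        IsMassiveState μ ∧ HasExponentialDecay (plaquetteCorrFn (fundamentalRep (Fin N)) μ) := by
  have hq : exp (Real.log (6 / 5)) = 6 / 5 := Real.exp_log (by norm_num)
  have h := loopNormLE_rectLoop (d := 4) (w := Real.log (6 / 5)) (ρ := 1 / 64) (τ := 1 / 2) (c := c)
    (Real.log_nonneg (by norm_num)) (by norm_num) (by norm_num) (by rw [hq]; norm_num) hc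
  have hP : Fintype.card {p : Fin 4 × Fin 4 // p.1 < p.2} = 6 := by decide
  rw [hq, hP] at h
  exact suN_loopFamily_massive_1_64 hN finite_fibre_rectLoop (h.mono (by norm_num))

end Rectangles

/-! ### All closed trails at once -/

section Trails

variable {c : TrailIdx 4 → ℝ}

/-- ★ **`SU(2)`, `d = 4`, `β_W = 1/16` — every coupling function on ALL closed trails with `‖c‖_{log 2} ≤ 0.143` gives a
MASSIVE theory**: `∑_{γ ∋ e} |c_γ| ∑_{y ∈ γ} 2^{‖e−y‖_∞} ≤ 0.143` through every link `e` ⇒ DLR states exist and every DLR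
state is massive (rate `log 2`) with plaquette–plaquette decay (rb-p1's `su2_allTrails_massGapS_1_16`). -/
theorem su2_allTrails_massive_1_16 (h : LoopNormLE (Real.log 2) trailLoop c (143 / 1000)) :
    (perturbedGibbsMeasuresS (d := 4) (fundamentalRep (Fin 2)) (((2 : ℕ) : ℝ) * ((1 / 16 : ℝ) / 4))
        (loopFamilyAction (d := 4) 2 trailLoop c)).Nonempty ∧
      ∀ μ ∈ perturbedGibbsMeasuresS (d := 4) (fundamentalRep (Fin 2)) (((2 : ℕ) : ℝ) * ((1 / 16 : ℝ) / 4))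
          (loopFamilyAction (d := 4) 2 trailLoop c),
        IsMassiveState μ ∧ HasExponentialDecay (plaquetteCorrFn (fundamentalRep (Fin 2)) μ) :=
  su2_loopFamily_massive_1_16 finite_fibre_trailLoop h

/-- **`SU(2)`, `d = 4`, `β_W = 1/20`**: all closed trails, `‖c‖_{log 2} ≤ 0.209` ⇒ every DLR state massive. -/
theorem su2_allTrails_massive_1_20 (h : LoopNormLE (Real.log 2) trailLoop c (209 / 1000)) :
    (perturbedGibbsMeasuresS (d := 4) (fundamentalRep (Fin 2)) (((2 : ℕ) : ℝ) * ((1 / 20 : ℝ) / 4))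
        (loopFamilyAction (d := 4) 2 trailLoop c)).Nonempty ∧
      ∀ μ ∈ perturbedGibbsMeasuresS (d := 4) (fundamentalRep (Fin 2)) (((2 : ℕ) : ℝ) * ((1 / 20 : ℝ) / 4))
          (loopFamilyAction (d := 4) 2 trailLoop c),
        IsMassiveState μ ∧ HasExponentialDecay (plaquetteCorrFn (fundamentalRep (Fin 2)) μ) :=
  su2_loopFamily_massive_1_20 finite_fibre_trailLoop h

/-- ★ **Every `N ≥ 2`, `d = 4`, 't Hooft `1/64`, hypothesis-free**: all closed trails, `‖c‖_{log (6/5)} ≤ 1/40` ⇒ DLR states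
exist and every DLR state is massive, `N`-uniformly (rb-p1's `suN_allTrails_massGapS_1_64`). -/
theorem suN_allTrails_massive_1_64 {N : ℕ} (hN : 2 ≤ N) (h : LoopNormLE (Real.log (6 / 5)) trailLoop c (1 / 40)) :
    (perturbedGibbsMeasuresS (d := 4) (fundamentalRep (Fin N)) ((N : ℝ) * (1 / 64))
        (loopFamilyAction (d := 4) N trailLoop c)).Nonempty ∧
      ∀ μ ∈ perturbedGibbsMeasuresS (d := 4) (fundamentalRep (Fin N)) ((N : ℝ) * (1 / 64))
          (loopFamilyAction (d := 4) N trailLoop c),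
        IsMassiveState μ ∧ HasExponentialDecay (plaquetteCorrFn (fundamentalRep (Fin N)) μ) :=
  suN_loopFamily_massive_1_64 hN finite_fibre_trailLoop h

/-- **`SU(3)`, `d = 4`, `β_W = 1/8`, given the two certified one-link constants** H1/H2: all closed trails,
`‖c‖_{log 2} ≤ 0.116` ⇒ every DLR state massive (rb-p1's `su3_allTrails_massGapS_1_8`), CONDITIONAL on H1/H2. -/
theorem su3_allTrails_massive_1_8 (hP : OneLinkPoincareSUN 3 (3 / 5) (4 / 5))
    (hV : OneLinkVarianceBound 3 (11 / 30) (49 / 20)) (h : LoopNormLE (Real.log 2) trailLoop c (29 / 250)) :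
    (perturbedGibbsMeasuresS (d := 4) (fundamentalRep (Fin 3)) (((3 : ℕ) : ℝ) * ((1 / 8 : ℝ) / 9))
        (loopFamilyAction (d := 4) 3 trailLoop c)).Nonempty ∧
      ∀ μ ∈ perturbedGibbsMeasuresS (d := 4) (fundamentalRep (Fin 3)) (((3 : ℕ) : ℝ) * ((1 / 8 : ℝ) / 9))
          (loopFamilyAction (d := 4) 3 trailLoop c),
        IsMassiveState μ ∧ HasExponentialDecay (plaquetteCorrFn (fundamentalRep (Fin 3)) μ) :=
  su3_loopFamily_massive_1_8 hP hV finite_fibre_trailLoop h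

end Trails

/-! ### Translation-invariant actions over all closed trail shapes -/

section Shapes

/-- ★ **`SU(2)`, `d = 4`, `β_W = 1/16` — EVERY translation-invariant generalized Wilson action over ALL closed trail shapes
with `∑_s |c₀(s)| |s|² 4^{|s|} ≤ 0.143` is a MASSIVE theory**: DLR states exist and every DLR state is massive (rate
`log 2`) with plaquette–plaquette decay (rb-p1's norm bound `loopNormLE_shapeLoop` with shape extent `2|s|`, as in
`su2_trailShapes_massGapS_1_16`; massive cell `su2_loopFamily_massive_1_16`). -/
theorem su2_trailShapes_massive_1_16 {c₀ : TrailShape 4 → ℝ}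
    (hsum : Summable fun s => |c₀ s| * (trailShape s).length ^ 2 * (4 : ℝ) ^ (trailShape s).length)
    (hε : ∑' s, |c₀ s| * (trailShape s).length ^ 2 * (4 : ℝ) ^ (trailShape s).length ≤ 143 / 1000) :
    (perturbedGibbsMeasuresS (d := 4) (fundamentalRep (Fin 2)) (((2 : ℕ) : ℝ) * ((1 / 16 : ℝ) / 4))
        (loopFamilyAction (d := 4) 2 (shapeLoop trailShape) fun i => c₀ i.2)).Nonempty ∧
      ∀ μ ∈ perturbedGibbsMeasuresS (d := 4) (fundamentalRep (Fin 2)) (((2 : ℕ) : ℝ) * ((1 / 16 : ℝ) / 4))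
          (loopFamilyAction (d := 4) 2 (shapeLoop trailShape) fun i => c₀ i.2),
        IsMassiveState μ ∧ HasExponentialDecay (plaquetteCorrFn (fundamentalRep (Fin 2)) μ) := by
  have hexp : ∀ s : TrailShape 4, exp (Real.log 2 * (2 * ((trailShape s).length : ℝ))) = (4 : ℝ) ^ (trailShape s).length :=
    fun s => by rw [exp_log_mul_two_mul (by norm_num : (0 : ℝ) < 2)]; norm_num
  have hnorm : LoopNormLE (Real.log 2) (shapeLoop trailShape) (fun i : Site 4 × TrailShape 4 => c₀ i.2) (143 / 1000) := by
    refine loopNormLE_shapeLoop (Real.log_nonneg (by norm_num)) norm_sub_le_trailShape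
      (D₀ := fun s => 2 * ((trailShape s).length : ℝ)) ?_ ?_
    · exact hsum.congr fun s => by rw [hexp]
    · calc ∑' s, |c₀ s| * ((trailShape s).length : ℝ) ^ 2 * exp (Real.log 2 * (2 * ((trailShape s).length : ℝ)))
          = ∑' s, |c₀ s| * ((trailShape s).length : ℝ) ^ 2 * (4 : ℝ) ^ (trailShape s).length :=
            tsum_congr fun s => by rw [hexp]
        _ ≤ 143 / 1000 := hε
  exact su2_loopFamily_massive_1_16 (finite_fibre_shapeLoop trailShape finite_fibre_trailShape length_trailShape_pos)
    hnorm

/-- ★ **Every `N ≥ 2`, `d = 4`, 't Hooft `1/64`, hypothesis-free** — translation-invariant actions over all closed trail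
shapes with `∑_s |c₀(s)| |s|² (36/25)^{|s|} ≤ 1/40`: DLR states exist and every DLR state is massive, `N`-uniformly
(rb-p1's `suN_trailShapes_massGapS_1_64`; massive cell `suN_loopFamily_massive_1_64`). -/
theorem suN_trailShapes_massive_1_64 {N : ℕ} (hN : 2 ≤ N) {c₀ : TrailShape 4 → ℝ}
    (hsum : Summable fun s => |c₀ s| * (trailShape s).length ^ 2 * (36 / 25 : ℝ) ^ (trailShape s).length)
    (hε : ∑' s, |c₀ s| * (trailShape s).length ^ 2 * (36 / 25 : ℝ) ^ (trailShape s).length ≤ 1 / 40) :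
    (perturbedGibbsMeasuresS (d := 4) (fundamentalRep (Fin N)) ((N : ℝ) * (1 / 64))
        (loopFamilyAction (d := 4) N (shapeLoop trailShape) fun i => c₀ i.2)).Nonempty ∧
      ∀ μ ∈ perturbedGibbsMeasuresS (d := 4) (fundamentalRep (Fin N)) ((N : ℝ) * (1 / 64))
          (loopFamilyAction (d := 4) N (shapeLoop trailShape) fun i => c₀ i.2),
        IsMassiveState μ ∧ HasExponentialDecay (plaquetteCorrFn (fundamentalRep (Fin N)) μ) := by
  have hexp : ∀ s : TrailShape 4,
      exp (Real.log (6 / 5) * (2 * ((trailShape s).length : ℝ))) = (36 / 25 : ℝ) ^ (trailShape s).length :=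
    fun s => by rw [exp_log_mul_two_mul (by norm_num : (0 : ℝ) < 6 / 5)]; norm_num
  have hnorm : LoopNormLE (Real.log (6 / 5)) (shapeLoop trailShape) (fun i : Site 4 × TrailShape 4 => c₀ i.2) (1 / 40) := by
    refine loopNormLE_shapeLoop (Real.log_nonneg (by norm_num)) norm_sub_le_trailShape
      (D₀ := fun s => 2 * ((trailShape s).length : ℝ)) ?_ ?_
    · exact hsum.congr fun s => by rw [hexp]
    · calc ∑' s, |c₀ s| * ((trailShape s).length : ℝ) ^ 2 * exp (Real.log (6 / 5) * (2 * ((trailShape s).length : ℝ)))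
          = ∑' s, |c₀ s| * ((trailShape s).length : ℝ) ^ 2 * (36 / 25 : ℝ) ^ (trailShape s).length :=
            tsum_congr fun s => by rw [hexp]
        _ ≤ 1 / 40 := hε
  exact suN_loopFamily_massive_1_64 hN (finite_fibre_shapeLoop trailShape finite_fibre_trailShape length_trailShape_pos)
    hnorm

end Shapes

end Summit.Ventures.YMGap.RobustBall

end
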